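import Summits.Ventures.Crystal3D.Theorems.StickyWulffConstantGenericWallFloorSealing
import Summits.Ventures.Crystal3D.Theorems.StickyWulffConstantGenericWallFloorSlabSealing
import Summits.Ventures.Crystal3D.Theorems.StickyWulffConstantTextureLiminfTexShadowCertificateDefs
import Summits.Ventures.Crystal3D.Theorems.StickyWulffConstantTextureLiminfBilayerUpperNeighbourCubic
import Literature.MathematicalPhysics.StatisticalMechanics.BarlowBilayers
import HarnessLib

/-!
# Barlow sealing: the upper-neighbour lemma for every Hägg stacking, and sealed clamp windows of Barlow plates
# (lane T, the T-side port of lane G's walker ledger; crux `TextureLiminf`, stmt-Ventures-19483)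

HONEST FRAMING. Venture `Summits/Ventures/Crystal3D` (cell `crystal3d-full`), helper `--supports` the crux
`TextureLiminf` (stmt-Ventures-19483) of `route-Ventures-StickyWulffConstant`, registered line `TexShadow` (v6.5; cf-p1
ROUTE.md §86(23) R / §86(26) U: the wall stubs `stub_bilayerWallGeneric` / `stub_bilayerWallResidual` conclude
`BilayerWallAt`, lane G's walker ledger with PER-TOP frames on BARLOW plates; the T-side port = Barlow sealing + inner-face
bookkeeping + flux count).  Rung credit only; F-C1 not moved.  This file is the BARLOW SEALING piece: lane G's
`…GenericWallFloorSealing` (`fcc_exists_near_ge`, `sealing_below/above`) is stated for moved fcc lattices; the wall cell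
of `BilayerWallAt` clamps plates of an arbitrary moved Hägg stacking `stacking L s σ`.

* `fccBilayer_exists_near_ge` — transfer of `D3_bilayer_exists_near_ge'` (`…TextureLiminfBilayerUpperNeighbourCubic`)
  to `Λ₀ = fccStacking 1 √(2/3)` through the cubic frame: a non-site `q` with `m√(2/3) ≤ q₂ ≤ (m+1)√(2/3)` has, for
  every `ν`, a site `v` of the two layers `barlowLayer … constHagg m ∪ barlowLayer … constHagg (m+1)` with `dist q v < 1`
  and `⟪q,ν⟫ ≤ ⟪v,ν⟫`;
* **`barlowStacking_exists_near_ge`** — for every Hägg word `σ`, every `q ∉ barlowStacking 1 √(2/3) σ` and every `ν`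
  there is a site `v` with `dist q v < 1` and `⟪q,ν⟫ ≤ ⟪v,ν⟫` (the bilayer whose closed slab contains `q` is the
  horizontal translate of an fcc bilayer if `σ k = 1`, its basal-mirror translate if `σ k = −1`:
  `Literature…BarlowBilayers.barlowBilayer_eq_[mirror_]translate_fcc_of_eq_[neg_]one`); `stacking_exists_near_ge`,
  `stacking_exists_near_above/below` — the moved forms for `stacking L s σ`;
* **`stacking_sealing_below` / `stacking_sealing_above`** — the sealing lemmas in the vocabulary of `BilayerWallAt`: for a
  unit-separated finite `X ⊇ P` with `p ∈ P ↔ p ∈ stacking L s σ ∧ a ≤ p₂ ≤ b ∧ p₀² + p₁² ≤ ρ²` and nothing of `X` below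
  height `a` (resp. above `b`), no ball of `X ∖ P` has `a ≤ q₂ ≤ b − 1` (resp. `a + 1 ≤ q₂ ≤ b`) and
  `q₀² + q₁² ≤ (ρ − 1)²`: the filling of the wall cell meets a clamped Barlow plate only through its inner unit skin and
  the lateral rim — there are no «floor extras» under the bottom plate and no «ceiling extras» over the top plate;
  `stacking_mem_sample_of_mem_core` — the clamp-free core statement (`…SlabSealing`) in the same vocabulary.
WHAT THIS IS NOT: not the wall law, no constants of the cell inequality; F-C1 not moved.
-/

noncomputable section

namespace Summit.Ventures.Crystal3D.Theorems

open Summit.Ventures.Crystal3D Finset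
open Literature.MathematicalPhysics.StatisticalMechanics (barlowPos barlowStacking barlowLayer fccStacking constHagg
  IsHaggSeq barlowPos_mem basalMirror barlowOffset)
open scoped InnerProductSpace

/-! ## The fcc bilayer and every Hägg stacking -/

/-- **Upper-neighbour lemma for one fcc bilayer.**  A point `q` in the closed slab between the `(111)` layers `m`,
`m+1` of `Λ₀ = fccStacking 1 √(2/3)` which is not a site of these two layers has, for every `ν`, a site `v` OF THESE
TWO LAYERS with `dist q v < 1` and `⟪q, ν⟫ ≤ ⟪v, ν⟫`. -/
theorem fccBilayer_exists_near_ge (q ν : EuclideanSpace ℝ (Fin 3)) (m : ℤ)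
    (hlo : (m : ℝ) * Real.sqrt (2 / 3) ≤ q 2) (hhi : q 2 ≤ ((m : ℝ) + 1) * Real.sqrt (2 / 3))
    (hq : q ∉ barlowLayer 1 (Real.sqrt (2 / 3)) constHagg m ∪ barlowLayer 1 (Real.sqrt (2 / 3)) constHagg (m + 1)) :
    ∃ v ∈ barlowLayer 1 (Real.sqrt (2 / 3)) constHagg m ∪ barlowLayer 1 (Real.sqrt (2 / 3)) constHagg (m + 1),
      dist q v < 1 ∧ ⟪q, ν⟫_ℝ ≤ ⟪v, ν⟫_ℝ := by
  obtain ⟨h3, h23⟩ := sqrt_three_sq_and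
  have hs0 : 0 ≤ Real.sqrt (2 / 3) := Real.sqrt_nonneg _
  -- `q` is not a site at all (a site of another layer has the wrong height)
  have hD : ∀ a b c : ℤ, Even (a + b + c) →
      ¬((a : ℝ) = q 0 + Real.sqrt 3 / 3 * q 1 - Real.sqrt (2 / 3) * q 2 ∧
        (b : ℝ) = q 0 - Real.sqrt 3 / 3 * q 1 + Real.sqrt (2 / 3) * q 2 ∧
        (c : ℝ) = 2 * Real.sqrt 3 / 3 * q 1 + Real.sqrt (2 / 3) * q 2) := by
    intro a b c he h
    have hmem := mem_fcc_of_cubic_int q a b c he h.1 h.2.1 h.2.2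
    obtain ⟨k, i, j, hk⟩ := hmem
    have hq2 : q 2 = (k : ℝ) * Real.sqrt (2 / 3) := by
      rw [hk]; exact Literature.MathematicalPhysics.StatisticalMechanics.barlowPos_apply_two 1 (Real.sqrt (2 / 3))
        constHagg k i j
    have hk1 : (m : ℝ) * Real.sqrt (2 / 3) * Real.sqrt (2 / 3) ≤ (k : ℝ) * Real.sqrt (2 / 3) * Real.sqrt (2 / 3) :=
      mul_le_mul_of_nonneg_right (by rw [← hq2]; exact hlo) hs0
    have hk2 : (k : ℝ) * Real.sqrt (2 / 3) * Real.sqrt (2 / 3) ≤ ((m : ℝ) + 1) * Real.sqrt (2 / 3) * Real.sqrt (2 / 3) :=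
      mul_le_mul_of_nonneg_right (by rw [← hq2]; exact hhi) hs0
    have e : Real.sqrt (2 / 3) * Real.sqrt (2 / 3) = 2 / 3 := by rw [← sq]; exact h23
    rw [mul_assoc, e, mul_assoc, e] at hk1 hk2
    have hmk : (m : ℝ) ≤ k := by linarith
    have hkm : (k : ℝ) ≤ m + 1 := by linarith
    have hmk' : m ≤ k := by exact_mod_cast hmk
    have hkm' : k ≤ m + 1 := by exact_mod_cast hkm
    rcases (show k = m ∨ k = m + 1 by omega) with rfl | rfl
    · exact hq (Or.inl ⟨i, j, hk⟩)
    · exact hq (Or.inr ⟨i, j, hk⟩)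
  -- the slab condition in cubic coordinates: `-A + B + C = 3 √(2/3) q₂ ∈ [2m, 2m+2]`
  have hsum : -(q 0 + Real.sqrt 3 / 3 * q 1 - Real.sqrt (2 / 3) * q 2) +
      (q 0 - Real.sqrt 3 / 3 * q 1 + Real.sqrt (2 / 3) * q 2) +
      (2 * Real.sqrt 3 / 3 * q 1 + Real.sqrt (2 / 3) * q 2) = 3 * (Real.sqrt (2 / 3) * q 2) := by ring
  have hlo' : 2 * (m : ℝ) ≤ 3 * (Real.sqrt (2 / 3) * q 2) := by
    have := mul_le_mul_of_nonneg_left hlo hs0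
    have e : Real.sqrt (2 / 3) * ((m : ℝ) * Real.sqrt (2 / 3)) = (m : ℝ) * (2 / 3) := by
      rw [mul_comm, mul_assoc, ← sq, h23]
    linarith
  have hhi' : 3 * (Real.sqrt (2 / 3) * q 2) ≤ 2 * (m : ℝ) + 2 := by
    have := mul_le_mul_of_nonneg_left hhi hs0
    have e : Real.sqrt (2 / 3) * (((m : ℝ) + 1) * Real.sqrt (2 / 3)) = ((m : ℝ) + 1) * (2 / 3) := by
      rw [mul_comm, mul_assoc, ← sq, h23]
    linarith
  obtain ⟨a, b, c, he, hlay, hd, hl⟩ := D3_bilayer_exists_near_ge'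
    (q 0 + Real.sqrt 3 / 3 * q 1 - Real.sqrt (2 / 3) * q 2)
    (q 0 - Real.sqrt 3 / 3 * q 1 + Real.sqrt (2 / 3) * q 2)
    (2 * Real.sqrt 3 / 3 * q 1 + Real.sqrt (2 / 3) * q 2)
    (ν 0 + Real.sqrt 3 / 3 * ν 1 - Real.sqrt (2 / 3) * ν 2)
    (ν 0 - Real.sqrt 3 / 3 * ν 1 + Real.sqrt (2 / 3) * ν 2)
    (2 * Real.sqrt 3 / 3 * ν 1 + Real.sqrt (2 / 3) * ν 2) m (by linarith) (by linarith) hD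
  obtain ⟨k, i, j, hij, hik, hjk⟩ := barlowPos_of_cubic a b c he
  obtain ⟨hA, hB, hC⟩ := cubic_barlowPos k i j
  have ha : (a : ℝ) = i + j := by exact_mod_cast hij.symm
  have hb : (b : ℝ) = i + k := by exact_mod_cast hik.symm
  have hc : (c : ℝ) = j + k := by exact_mod_cast hjk.symm
  have hk : k = m ∨ k = m + 1 := by omega
  rw [ha, ← hA, hb, ← hB, hc, ← hC] at hd hl
  refine ⟨barlowPos 1 (Real.sqrt (2 / 3)) constHagg k i j, ?_, dist_lt_one_of_cubic _ _ hd,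
    inner_le_inner_of_cubic _ _ _ hl⟩
  rcases hk with rfl | rfl
  · exact Or.inl ⟨i, j, rfl⟩
  · exact Or.inr ⟨i, j, rfl⟩

/-- A layer of a Barlow stacking lies in the stacking. -/
theorem barlowLayer_subset_barlowStacking (a h : ℝ) (σ : ℤ → ℤ) (k : ℤ) :
    barlowLayer a h σ k ⊆ barlowStacking a h σ := by
  rintro x ⟨i, j, rfl⟩
  exact ⟨k, i, j, rfl⟩

/-- The basal mirror is self-adjoint: `⟪M x, ν⟫ = ⟪x, M ν⟫`. -/
theorem inner_basalMirror_left_eq_right (x ν : EuclideanSpace ℝ (Fin 3)) :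
    ⟪basalMirror x, ν⟫_ℝ = ⟪x, basalMirror ν⟫_ℝ := by
  have h := LinearIsometryEquiv.inner_map_map basalMirror x (basalMirror ν)
  rw [Literature.MathematicalPhysics.StatisticalMechanics.basalMirror_basalMirror] at h
  exact h

/-- **Upper-neighbour lemma for every Hägg stacking.**  For a Hägg word `σ`, every `q ∉ barlowStacking 1 √(2/3) σ`
and every `ν` there is a site `v` of the stacking with `dist q v < 1` and `⟪q, ν⟫ ≤ ⟪v, ν⟫`: the bilayer of the
stacking whose closed slab contains `q` is a moved fcc bilayer (`Literature…BarlowBilayers`), and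
`fccBilayer_exists_near_ge` applies there. -/
theorem barlowStacking_exists_near_ge {σ : ℤ → ℤ} (hσ : IsHaggSeq σ) (q ν : EuclideanSpace ℝ (Fin 3))
    (hq : q ∉ barlowStacking 1 (Real.sqrt (2 / 3)) σ) :
    ∃ v ∈ barlowStacking 1 (Real.sqrt (2 / 3)) σ, dist q v < 1 ∧ ⟪q, ν⟫_ℝ ≤ ⟪v, ν⟫_ℝ := by
  set hh : ℝ := Real.sqrt (2 / 3) with hhdef
  have hpos : 0 < hh := Real.sqrt_pos.2 (by norm_num)
  -- the bilayer index
  set k : ℤ := ⌊q 2 / hh⌋ with hkdef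
  have hk1 : (k : ℝ) ≤ q 2 / hh := Int.floor_le _
  have hk2 : q 2 / hh < (k : ℝ) + 1 := Int.lt_floor_add_one _
  have hlo : (k : ℝ) * hh ≤ q 2 := by rwa [le_div_iff₀ hpos] at hk1
  have hhi : q 2 ≤ ((k : ℝ) + 1) * hh := by rw [div_lt_iff₀ hpos] at hk2; exact hk2.le
  rcases hσ k with hk | hk
  · -- step `+1`: the bilayer is the horizontal translate of the fcc bilayer `(k, k+1)`
    obtain ⟨h0, h1⟩ := Literature.MathematicalPhysics.StatisticalMechanics.barlowBilayer_eq_translate_fcc_of_eq_one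
      1 hh σ k hk
    set c : ℝ := (Literature.MathematicalPhysics.StatisticalMechanics.haggLabel σ k : ℝ) - k with hcdef
    obtain ⟨q', hq'def⟩ : ∃ q' : EuclideanSpace ℝ (Fin 3), q' = q + (-c) • barlowOffset 1 := ⟨_, rfl⟩
    have hqq : q' + c • barlowOffset 1 = q := by
      rw [hq'def, add_assoc, ← add_smul, neg_add_cancel, zero_smul, add_zero]
    have hq'2 : q' 2 = q 2 := by
      rw [hq'def]; exact Literature.MathematicalPhysics.StatisticalMechanics.translate_barlowOffset_apply_two 1 (-c) q
    have hq' : q' ∉ barlowLayer 1 hh constHagg k ∪ barlowLayer 1 hh constHagg (k + 1) := by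
      rintro (h' | h')
      · exact hq (barlowLayer_subset_barlowStacking 1 hh σ k (by rw [h0]; exact ⟨q', h', hqq⟩))
      · exact hq (barlowLayer_subset_barlowStacking 1 hh σ (k + 1) (by rw [h1]; exact ⟨q', h', hqq⟩))
    obtain ⟨v', hv', hd, hl⟩ := fccBilayer_exists_near_ge q' ν k (by rw [hq'2]; exact hlo)
      (by rw [hq'2]; exact hhi) hq'
    refine ⟨v' + c • barlowOffset 1, ?_, ?_, ?_⟩
    · rcases hv' with hv' | hv'
      · exact barlowLayer_subset_barlowStacking 1 hh σ k (by rw [h0]; exact ⟨v', hv', rfl⟩)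
      · exact barlowLayer_subset_barlowStacking 1 hh σ (k + 1) (by rw [h1]; exact ⟨v', hv', rfl⟩)
    · rw [← hqq, dist_add_right]; exact hd
    · calc ⟪q, ν⟫_ℝ = ⟪q' + c • barlowOffset 1, ν⟫_ℝ := by rw [hqq]
        _ = ⟪q', ν⟫_ℝ + ⟪c • barlowOffset 1, ν⟫_ℝ := inner_add_left _ _ _
        _ ≤ ⟪v', ν⟫_ℝ + ⟪c • barlowOffset 1, ν⟫_ℝ := by linarith
        _ = ⟪v' + c • barlowOffset 1, ν⟫_ℝ := (inner_add_left _ _ _).symm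
  · -- step `−1`: the bilayer is the mirror-translate of the fcc bilayer `(−k−1, −k)`
    obtain ⟨h0, h1⟩ :=
      Literature.MathematicalPhysics.StatisticalMechanics.barlowBilayer_eq_mirror_translate_fcc_of_eq_neg_one 1 hh σ k hk
    set c : ℝ := (Literature.MathematicalPhysics.StatisticalMechanics.haggLabel σ k : ℝ) + k with hcdef
    obtain ⟨q', hq'def⟩ : ∃ q' : EuclideanSpace ℝ (Fin 3), q' = basalMirror (q + (-c) • barlowOffset 1) := ⟨_, rfl⟩
    have hMM := Literature.MathematicalPhysics.StatisticalMechanics.basalMirror_basalMirror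
    have hqq : basalMirror q' + c • barlowOffset 1 = q := by
      rw [hq'def, hMM, add_assoc, ← add_smul, neg_add_cancel, zero_smul, add_zero]
    have hq'2 : q' 2 = -q 2 := by
      rw [hq'def, Literature.MathematicalPhysics.StatisticalMechanics.basalMirror_apply_coord, if_pos rfl,
        Literature.MathematicalPhysics.StatisticalMechanics.translate_barlowOffset_apply_two 1 (-c) q]
    have hq' : q' ∉ barlowLayer 1 hh constHagg (-(k + 1)) ∪ barlowLayer 1 hh constHagg (-(k + 1) + 1) := by
      rintro (h' | h')
      · exact hq (barlowLayer_subset_barlowStacking 1 hh σ (k + 1) (by rw [h1]; exact ⟨q', h', hqq⟩))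
      · rw [show -(k + 1) + 1 = -k by ring] at h'
        exact hq (barlowLayer_subset_barlowStacking 1 hh σ k (by rw [h0]; exact ⟨q', h', hqq⟩))
    obtain ⟨v', hv', hd, hl⟩ := fccBilayer_exists_near_ge q' (basalMirror ν) (-(k + 1))
      (by rw [hq'2]; push_cast; linarith) (by rw [hq'2]; push_cast; linarith) hq'
    refine ⟨basalMirror v' + c • barlowOffset 1, ?_, ?_, ?_⟩
    · rcases hv' with hv' | hv'
      · exact barlowLayer_subset_barlowStacking 1 hh σ (k + 1) (by rw [h1]; exact ⟨v', hv', rfl⟩)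
      · rw [show -(k + 1) + 1 = -k by ring] at hv'
        exact barlowLayer_subset_barlowStacking 1 hh σ k (by rw [h0]; exact ⟨v', hv', rfl⟩)
    · rw [← hqq, dist_add_right, LinearIsometryEquiv.dist_map]; exact hd
    · calc ⟪q, ν⟫_ℝ = ⟪basalMirror q' + c • barlowOffset 1, ν⟫_ℝ := by rw [hqq]
        _ = ⟪q', basalMirror ν⟫_ℝ + ⟪c • barlowOffset 1, ν⟫_ℝ := by rw [inner_add_left, inner_basalMirror_left_eq_right]
        _ ≤ ⟪v', basalMirror ν⟫_ℝ + ⟪c • barlowOffset 1, ν⟫_ℝ := by linarith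
        _ = ⟪basalMirror v' + c • barlowOffset 1, ν⟫_ℝ := by rw [inner_add_left, inner_basalMirror_left_eq_right]

open Summit.Ventures.Crystal3D.Cruxes.TextureLiminf.TexShadow (E3 stacking)

/-- **Upper-neighbour lemma for a moved Hägg stacking** `stacking L s σ = L·(barlowStacking σ) + s`: every
`q ∉ stacking L s σ` has, for every `ν`, a site `v` with `dist q v < 1` and `⟪q,ν⟫ ≤ ⟪v,ν⟫`. -/
theorem stacking_exists_near_ge {σ : ℤ → ℤ} (hσ : IsHaggSeq σ) (L : E3 ≃ₗᵢ[ℝ] E3) (s q ν : E3)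
    (hq : q ∉ stacking L s σ) :
    ∃ v ∈ stacking L s σ, dist q v < 1 ∧ ⟪q, ν⟫_ℝ ≤ ⟪v, ν⟫_ℝ := by
  set q' := L.symm (q - s) with hq'
  have hqq : L q' + s = q := by rw [hq', LinearIsometryEquiv.apply_symm_apply, sub_add_cancel]
  have hq'Λ : q' ∉ barlowStacking 1 (Real.sqrt (2 / 3)) σ := fun h => hq ⟨q', h, hqq⟩
  obtain ⟨v', hv'Λ, hd, hl⟩ := barlowStacking_exists_near_ge hσ q' (L.symm ν) hq'Λ
  refine ⟨L v' + s, ⟨v', hv'Λ, rfl⟩, ?_, ?_⟩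
  · rw [← hqq, dist_add_right, LinearIsometryEquiv.dist_map]; exact hd
  · have hν : L (L.symm ν) = ν := LinearIsometryEquiv.apply_symm_apply _ _
    have h1 : ⟪q', L.symm ν⟫_ℝ = ⟪L q', ν⟫_ℝ := by
      rw [← LinearIsometryEquiv.inner_map_map L q' (L.symm ν), hν]
    have h2 : ⟪v', L.symm ν⟫_ℝ = ⟪L v', ν⟫_ℝ := by
      rw [← LinearIsometryEquiv.inner_map_map L v' (L.symm ν), hν]
    rw [← hqq, inner_add_left, inner_add_left, ← h1, ← h2]
    linarith

/-- **A near site at least as high**: every `q ∉ stacking L s σ` has a site `v` with `dist q v < 1` and `q₂ ≤ v₂`. -/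
theorem stacking_exists_near_above {σ : ℤ → ℤ} (hσ : IsHaggSeq σ) (L : E3 ≃ₗᵢ[ℝ] E3) (s q : E3)
    (hq : q ∉ stacking L s σ) : ∃ v ∈ stacking L s σ, dist q v < 1 ∧ q 2 ≤ v 2 := by
  obtain ⟨v, hv, hd, hl⟩ := stacking_exists_near_ge hσ L s q (EuclideanSpace.single (2 : Fin 3) (1 : ℝ)) hq
  rw [inner_single_two_one, inner_single_two_one] at hl
  exact ⟨v, hv, hd, hl⟩

/-- **A near site at most as high**: every `q ∉ stacking L s σ` has a site `v` with `dist q v < 1` and `v₂ ≤ q₂`. -/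
theorem stacking_exists_near_below {σ : ℤ → ℤ} (hσ : IsHaggSeq σ) (L : E3 ≃ₗᵢ[ℝ] E3) (s q : E3)
    (hq : q ∉ stacking L s σ) : ∃ v ∈ stacking L s σ, dist q v < 1 ∧ v 2 ≤ q 2 := by
  obtain ⟨v, hv, hd, hl⟩ := stacking_exists_near_ge hσ L s q (-EuclideanSpace.single (2 : Fin 3) (1 : ℝ)) hq
  rw [inner_neg_right, inner_neg_right, inner_single_two_one, inner_single_two_one] at hl
  exact ⟨v, hv, hd, by linarith⟩

/-! ## The sealing lemmas for clamped Barlow plates (vocabulary of `BilayerWallAt`) -/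

/-- **Sealing below (bottom plate).**  Let `X` be a finite unit-separated set and `P ⊆ X` the complete slab sample
`P = {p : p ∈ stacking L s σ, a ≤ p₂ ≤ b, p₀² + p₁² ≤ ρ²}` (`ρ ≥ 1`, `σ` a Hägg word).  Then NO point `q ∈ X ∖ P`
has `a ≤ q₂ ≤ b − 1` and `q₀² + q₁² ≤ (ρ − 1)²`.  (Bottom clamp of the wall cell: `a = −2R₀` is the container floor, so
`a ≤ q₂` holds for every ball — there are no «floor extras».) -/
theorem stacking_sealing_below {σ : ℤ → ℤ} (hσ : IsHaggSeq σ) (L : E3 ≃ₗᵢ[ℝ] E3) (s : E3)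
    (a b ρ : ℝ) (hρ : 1 ≤ ρ) (X P : Finset E3)
    (hX : ∀ p ∈ X, ∀ q ∈ X, p ≠ q → 1 ≤ dist p q) (hPX : P ⊆ X)
    (hP : ∀ p, p ∈ P ↔ (p ∈ stacking L s σ ∧ a ≤ p 2 ∧ p 2 ≤ b ∧ p 0 ^ 2 + p 1 ^ 2 ≤ ρ ^ 2))
    (q : E3) (hqX : q ∈ X) (hqP : q ∉ P)
    (ha : a ≤ q 2) (hb : q 2 ≤ b - 1) (hr : q 0 ^ 2 + q 1 ^ 2 ≤ (ρ - 1) ^ 2) : False := by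
  have hρ' : (ρ - 1) ^ 2 ≤ ρ ^ 2 := by nlinarith
  by_cases hqΛ : q ∈ stacking L s σ
  · exact hqP ((hP q).2 ⟨hqΛ, ha, by linarith, hr.trans hρ'⟩)
  obtain ⟨v, hvΛ, hd, hz⟩ := stacking_exists_near_above hσ L s q hqΛ
  rw [dist_comm] at hd
  have hd2 : dist v q ^ 2 < 1 := by
    have := pow_lt_pow_left₀ hd dist_nonneg (two_ne_zero)
    simpa using this
  have hsq := dist_sq_eq_three v q
  have hz' : v 2 < q 2 + 1 := by nlinarith [sq_nonneg (v 0 - q 0), sq_nonneg (v 1 - q 1)]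
  have hlat : v 0 ^ 2 + v 1 ^ 2 ≤ ρ ^ 2 := by
    have := lateral_sq_le_of_dist_le_one (y := v) (q := q) (r := ρ - 1) (by linarith) hr hd.le
    simpa using this
  have hvP : v ∈ P := (hP v).2 ⟨hvΛ, by linarith, by linarith, hlat⟩
  have hne : v ≠ q := fun h => hqΛ (h ▸ hvΛ)
  have := hX v (hPX hvP) q hqX hne
  linarith

/-- **Sealing above (top plate).**  Same setting; NO point `q ∈ X ∖ P` has `a + 1 ≤ q₂ ≤ b` and
`q₀² + q₁² ≤ (ρ − 1)²`.  (Top clamp: `b = h + 2R₀` is the container ceiling — no «ceiling extras».) -/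
theorem stacking_sealing_above {σ : ℤ → ℤ} (hσ : IsHaggSeq σ) (L : E3 ≃ₗᵢ[ℝ] E3) (s : E3)
    (a b ρ : ℝ) (hρ : 1 ≤ ρ) (X P : Finset E3)
    (hX : ∀ p ∈ X, ∀ q ∈ X, p ≠ q → 1 ≤ dist p q) (hPX : P ⊆ X)
    (hP : ∀ p, p ∈ P ↔ (p ∈ stacking L s σ ∧ a ≤ p 2 ∧ p 2 ≤ b ∧ p 0 ^ 2 + p 1 ^ 2 ≤ ρ ^ 2))
    (q : E3) (hqX : q ∈ X) (hqP : q ∉ P)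
    (ha : a + 1 ≤ q 2) (hb : q 2 ≤ b) (hr : q 0 ^ 2 + q 1 ^ 2 ≤ (ρ - 1) ^ 2) : False := by
  have hρ' : (ρ - 1) ^ 2 ≤ ρ ^ 2 := by nlinarith
  by_cases hqΛ : q ∈ stacking L s σ
  · exact hqP ((hP q).2 ⟨hqΛ, by linarith, hb, hr.trans hρ'⟩)
  obtain ⟨v, hvΛ, hd, hz⟩ := stacking_exists_near_below hσ L s q hqΛ
  rw [dist_comm] at hd
  have hd2 : dist v q ^ 2 < 1 := by
    have := pow_lt_pow_left₀ hd dist_nonneg (two_ne_zero)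
    simpa using this
  have hsq := dist_sq_eq_three v q
  have hz' : q 2 - 1 < v 2 := by nlinarith [sq_nonneg (v 0 - q 0), sq_nonneg (v 1 - q 1)]
  have hlat : v 0 ^ 2 + v 1 ^ 2 ≤ ρ ^ 2 := by
    have := lateral_sq_le_of_dist_le_one (y := v) (q := q) (r := ρ - 1) (by linarith) hr hd.le
    simpa using this
  have hvP : v ∈ P := (hP v).2 ⟨hvΛ, by linarith, by linarith, hlat⟩
  have hne : v ≠ q := fun h => hqΛ (h ▸ hvΛ)
  have := hX v (hPX hvP) q hqX hne
  linarith

/-- **Core sealing (either plate, no clamp needed).**  In the same setting, a ball of `X` in the CORE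
`a + 1 ≤ q₂ ≤ b − 1`, `q₀² + q₁² ≤ (ρ − 1)²` of the window is a plate ball (`…SlabSealing.mem_sample_of_mem_core`, restated
for `stacking L s σ`; any `σ`). -/
theorem stacking_mem_sample_of_mem_core (σ : ℤ → ℤ) (L : E3 ≃ₗᵢ[ℝ] E3) (s : E3)
    (X P : Finset E3) (a b ρ : ℝ) (hρ : 1 ≤ ρ) (hPX : P ⊆ X)
    (hX : ∀ x ∈ X, ∀ y ∈ X, x ≠ y → 1 ≤ dist x y)
    (hP : ∀ p, p ∈ P ↔ (p ∈ stacking L s σ ∧ a ≤ p 2 ∧ p 2 ≤ b ∧ p 0 ^ 2 + p 1 ^ 2 ≤ ρ ^ 2))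
    (x : E3) (hx : x ∈ X) (hxa : a + 1 ≤ x 2) (hxb : x 2 ≤ b - 1)
    (hxr : x 0 ^ 2 + x 1 ^ 2 ≤ (ρ - 1) ^ 2) : x ∈ P :=
  mem_sample_of_mem_core σ L s X P a b ρ hρ hPX hX (fun p hp h1 h2 h3 => (hP p).2 ⟨hp, h1, h2, h3⟩) x hx hxa hxb hxr

end Summit.Ventures.Crystal3D.Theorems

end
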